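import Mathlib
import Summits.AtomisticToContinuum.Crystallization.Theorems.GappedShellCensusFiveFoldRationingRStubFfrLens
import Summits.AtomisticToContinuum.Crystallization.Theorems.GappedShellCensusFiveFoldRationingRStubFfrCircle
import Summits.AtomisticToContinuum.Crystallization.Theorems.GappedShellCensusFiveFoldRationingRStubFfrNoFreeSurface
import Summits.AtomisticToContinuum.Crystallization.Theorems.GappedShellCensusFiveFoldRationingRStubFfrRelDense
import Summits.AtomisticToContinuum.Crystallization.Theorems.GappedShellCensusFiveFoldRationingRStubFfrRodTransferAux

/-!
# Crux `GappedShellCensus.FiveFoldRationingR` (stmt-AtomisticToContinuum-18071), line `Sketch` —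
# stub `stub_ffrRodTransfer` (the rod on `Y` from the graph theorem and volume growth)

Pure plumbing.  Given the abstract graph theorem RG (connected simple graph with cubocta / anticubocta /
prism labelled links and cubic ball growth ⇒ five-fold walks between five-sites and a height function)
and volume growth VG (hard core + `3a`-denseness ⇒ `n³` sites in `B(p, 13 a n)`), the rod statement on
an all-gapped-twelve `Y ⊆ ℝ³` follows by applying RG to the BOND GRAPH `G` on the subtype `↥Y`
(`u ~ v ↔ u ≠ v ∧ dist u v ≤ a (1 + 1/50)`, helper file `…StubFfrRodTransferAux`):
* labelled links of `G` = the link-type hypothesis `hL` (`ffrRT_links`);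
* `G` is connected, with walks of length `≤ 4·dist/a + 3`, by the greedy-routing hypothesis
  (`ffrRT_walk`, `ffrRT_connected`);
* cubic growth of graph balls (`ffrRT_growth`): `3a`-denseness of `Y` is the landed chain
  `stub_ffrLens` + `stub_ffrCircle` ⇒ `stub_ffrNoFreeSurface` ⇒ `stub_ffrRelDense`, then VG and the
  walk bound put the `n³` sites of `B(v, 13 a n)`, `n = ⌊R/55⌋`, inside the graph ball of radius `R`;
* the two conclusions are transported back along `Subtype.val` (`ffrRT_fiveSite`,
  `ffrRT_fiveBond_iff`; the height function is extended by `0` off `Y`).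
-/

noncomputable section

namespace Summit.AtomisticToContinuum.Crystallization.Theorems


/-- Extension by zero off `Y` of a function on the subtype `↥Y`: on `Y` it restricts back to the given
function (the height function of the bond graph is transported to `ℝ³` this way). -/
theorem ffrRT_extend_val {Y : Set (EuclideanSpace ℝ (Fin 3))} (h : ↥Y → ℝ)
    (x : EuclideanSpace ℝ (Fin 3)) (hx : x ∈ Y) :
    Function.extend Subtype.val h 0 x = h ⟨x, hx⟩ :=
  Subtype.val_injective.extend_apply h 0 ⟨x, hx⟩

/-- **Stub RT (TRANSFER; provable now, worker).** The graph theorem `stub_ffrRodGraph` and volume growth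
`stub_ffrVolGrowth` give the rod statement on `Y`: apply RG to the bond graph on the subtype `↥Y`
(`u ~ v ↔ u ≠ v ∧ dist u v ≤ 1.02a`; labelled links = hypothesis `hL`; connected and
`graph_dist ≤ 4·dist/a + 3` = the greedy-routing hypothesis; cubic growth of graph balls from VG + hard
core + greedy), and transport five-bond sets, walks and `h` along `Subtype.val`. Pure plumbing. [folklore] -/
theorem stub_ffrRodTransfer :
    (∀ (V : Type) (G : SimpleGraph V),
        (∀ v : V, ∃ e : Fin 12 → V, Function.Injective e ∧ Set.range e = {w | G.Adj v w} ∧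
          ((∀ i j : Fin 12, i < j → (G.Adj (e i) (e j) ↔
              (i.val, j.val) ∈ ([(0, 4), (0, 5), (0, 8), (0, 9), (1, 4), (1, 5), (1, 10), (1, 11), (2, 6), (2, 7),
                  (2, 8), (2, 9), (3, 6), (3, 7), (3, 10), (3, 11), (4, 8), (4, 10), (5, 9), (5, 11),
                  (6, 8), (6, 10), (7, 9), (7, 11)] : List (ℕ × ℕ)))) ∨
            (∀ i j : Fin 12, i < j → (G.Adj (e i) (e j) ↔
              (i.val, j.val) ∈ ([(0, 2), (0, 5), (0, 7), (0, 10), (1, 3), (1, 4), (1, 8), (1, 11), (2, 4), (2, 6),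
                  (2, 9), (3, 5), (3, 8), (3, 11), (4, 6), (4, 9), (5, 7), (5, 10), (6, 7), (6, 8),
                  (7, 8), (9, 10), (9, 11), (10, 11)] : List (ℕ × ℕ)))) ∨
            (∀ i j : Fin 12, i < j → (G.Adj (e i) (e j) ↔
              (i.val, j.val) ∈ ([(0, 1), (0, 2), (0, 3), (0, 4), (0, 5), (1, 2), (1, 5), (1, 6), (2, 3), (2, 7), (3, 4),
                  (3, 8), (4, 5), (4, 9), (5, 10), (6, 7), (6, 10), (6, 11), (7, 8), (7, 11), (8, 9),
                  (8, 11), (9, 10), (9, 11), (10, 11)] : List (ℕ × ℕ)))))) →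
        G.Connected →
        (∃ (r₀ : ℕ) (c : ℝ), 0 < c ∧ ∀ (v : V) (r : ℕ), r₀ ≤ r →
          c * (r : ℝ) ^ 3 ≤ (({w | G.dist v w ≤ r} : Set V).ncard : ℝ)) →
        (∀ y ∈ {y : V | ∃ v, G.Adj y v ∧ 5 ≤ ({w | G.Adj y w ∧ G.Adj v w} : Set V).ncard},
          ∀ y' ∈ {y : V | ∃ v, G.Adj y v ∧ 5 ≤ ({w | G.Adj y w ∧ G.Adj v w} : Set V).ncard},
          ∃ f : ℕ → V, f 0 = y ∧
            (∀ n, f (n + 1) ∈ {v | G.Adj (f n) v ∧ 5 ≤ ({w | G.Adj (f n) w ∧ G.Adj v w} : Set V).ncard}) ∧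
            ∃ n, f n = y') ∧
        (∃ h : V → ℝ,
          (∀ u v : V, G.Adj u v → |h u - h v| ≤ 1) ∧
          (∀ y : V, ∀ v ∈ {v | G.Adj y v ∧ 5 ≤ ({w | G.Adj y w ∧ G.Adj v w} : Set V).ncard}, |h y - h v| = 1) ∧
          (∀ y : V, ∀ v ∈ {v | G.Adj y v ∧ 5 ≤ ({w | G.Adj y w ∧ G.Adj v w} : Set V).ncard},
            ∀ v' ∈ {v | G.Adj y v ∧ 5 ≤ ({w | G.Adj y w ∧ G.Adj v w} : Set V).ncard},
            v ≠ v' → h v + h v' = 2 * h y))) →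
    (∀ (Y : Set (EuclideanSpace ℝ (Fin 3))) (a : ℝ), 0 < a →
        (∀ y ∈ Y, ∀ w ∈ Y, w ≠ y → a * (1 - 1 / 50) ≤ dist y w) →
        (∀ p : EuclideanSpace ℝ (Fin 3), ∃ y ∈ Y, dist p y ≤ 3 * a) →
        ∀ (p : EuclideanSpace ℝ (Fin 3)) (n : ℕ),
          (n : ℝ) ^ 3 ≤ ((Y ∩ Metric.closedBall p (13 * a * n)).ncard : ℝ)) →
    ∀ (Y : Set (EuclideanSpace ℝ (Fin 3))) (a : ℝ), 0 < a → Y.Nonempty →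
      (∀ y ∈ Y, ({w ∈ Y | w ≠ y ∧ dist y w ≤ a * (1 + 1 / 50)}.ncard = 12 ∧
        ∀ w ∈ Y, w ≠ y → a * (1 - 1 / 50) ≤ dist y w ∧
          (dist y w ≤ a * (1 + 1 / 50) ∨ a * (63 / 50) ≤ dist y w))) →
      (∀ y ∈ Y, ∀ v ∈ Y, v ≠ y → dist y v ≤ a * (1 + 1 / 50) →
        4 ≤ {w ∈ Y | w ≠ y ∧ w ≠ v ∧ dist y w ≤ a * (1 + 1 / 50) ∧ dist v w ≤ a * (1 + 1 / 50)}.ncard) →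
      (∀ y ∈ Y, ∀ v ∈ Y, v ≠ y → dist y v ≤ a * (1 + 1 / 50) →
        {w ∈ Y | w ≠ y ∧ w ≠ v ∧ dist y w ≤ a * (1 + 1 / 50) ∧ dist v w ≤ a * (1 + 1 / 50)}.ncard ≤ 5) →
      (∀ y ∈ Y, Even {v ∈ Y | v ≠ y ∧ dist y v ≤ a * (1 + 1 / 50) ∧
          5 ≤ {w ∈ Y | w ≠ y ∧ w ≠ v ∧ dist y w ≤ a * (1 + 1 / 50) ∧
            dist v w ≤ a * (1 + 1 / 50)}.ncard}.ncard) →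
      (∀ y ∈ Y, {v ∈ Y | v ≠ y ∧ dist y v ≤ a * (1 + 1 / 50) ∧
          5 ≤ {w ∈ Y | w ≠ y ∧ w ≠ v ∧ dist y w ≤ a * (1 + 1 / 50) ∧
            dist v w ≤ a * (1 + 1 / 50)}.ncard} = ∅ ∨
        ({v ∈ Y | v ≠ y ∧ dist y v ≤ a * (1 + 1 / 50) ∧
          5 ≤ {w ∈ Y | w ≠ y ∧ w ≠ v ∧ dist y w ≤ a * (1 + 1 / 50) ∧
            dist v w ≤ a * (1 + 1 / 50)}.ncard}).ncard = 2) →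
      (∀ y₀ ∈ Y, ∀ v₀ ∈ {v ∈ Y | v ≠ y₀ ∧ dist y₀ v ≤ a * (1 + 1 / 50) ∧
          5 ≤ {w ∈ Y | w ≠ y₀ ∧ w ≠ v ∧ dist y₀ w ≤ a * (1 + 1 / 50) ∧
            dist v w ≤ a * (1 + 1 / 50)}.ncard},
        ∃ f : ℕ → EuclideanSpace ℝ (Fin 3), f 0 = y₀ ∧ f 1 = v₀ ∧ (∀ n, f n ∈ Y) ∧
          (∀ n, f (n + 1) ∈ {v ∈ Y | v ≠ (f n) ∧ dist (f n) v ≤ a * (1 + 1 / 50) ∧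
          5 ≤ {w ∈ Y | w ≠ (f n) ∧ w ≠ v ∧ dist (f n) w ≤ a * (1 + 1 / 50) ∧
            dist v w ≤ a * (1 + 1 / 50)}.ncard}) ∧
          (∀ n, f (n + 2) ≠ f n)) →
      (∀ y ∈ Y, ∃ e : Fin 12 → EuclideanSpace ℝ (Fin 3), Function.Injective e ∧
        Set.range e = {w ∈ Y | w ≠ y ∧ dist y w ≤ a * (1 + 1 / 50)} ∧
        ((∀ i j : Fin 12, i < j → (dist (e i) (e j) ≤ a * (1 + 1 / 50) ↔
            (i.val, j.val) ∈ ([(0, 4), (0, 5), (0, 8), (0, 9), (1, 4), (1, 5), (1, 10), (1, 11), (2, 6), (2, 7),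
                (2, 8), (2, 9), (3, 6), (3, 7), (3, 10), (3, 11), (4, 8), (4, 10), (5, 9), (5, 11),
                (6, 8), (6, 10), (7, 9), (7, 11)] : List (ℕ × ℕ)))) ∨
          (∀ i j : Fin 12, i < j → (dist (e i) (e j) ≤ a * (1 + 1 / 50) ↔
            (i.val, j.val) ∈ ([(0, 2), (0, 5), (0, 7), (0, 10), (1, 3), (1, 4), (1, 8), (1, 11), (2, 4), (2, 6),
                (2, 9), (3, 5), (3, 8), (3, 11), (4, 6), (4, 9), (5, 7), (5, 10), (6, 7), (6, 8),
                (7, 8), (9, 10), (9, 11), (10, 11)] : List (ℕ × ℕ)))) ∨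
          (∀ i j : Fin 12, i < j → (dist (e i) (e j) ≤ a * (1 + 1 / 50) ↔
            (i.val, j.val) ∈ ([(0, 1), (0, 2), (0, 3), (0, 4), (0, 5), (1, 2), (1, 5), (1, 6), (2, 3), (2, 7), (3, 4),
                (3, 8), (4, 5), (4, 9), (5, 10), (6, 7), (6, 10), (6, 11), (7, 8), (7, 11), (8, 9),
                (8, 11), (9, 10), (9, 11), (10, 11)] : List (ℕ × ℕ)))))) →
      (∀ u ∈ Y, ∀ v ∈ Y, ∃ (n : ℕ) (g : ℕ → EuclideanSpace ℝ (Fin 3)), g 0 = u ∧ g n = v ∧ (∀ k, g k ∈ Y) ∧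
        (∀ k, k < n → dist (g k) (g (k + 1)) ≤ a * (1 + 1 / 50)) ∧ (n : ℝ) ≤ 4 * dist u v / a + 3) →
      (∀ y ∈ {y ∈ Y | ∃ v ∈ Y, v ≠ y ∧ dist y v ≤ a * (1 + 1 / 50) ∧
          5 ≤ {w ∈ Y | w ≠ y ∧ w ≠ v ∧ dist y w ≤ a * (1 + 1 / 50) ∧
            dist v w ≤ a * (1 + 1 / 50)}.ncard},
        ∀ y' ∈ {y ∈ Y | ∃ v ∈ Y, v ≠ y ∧ dist y v ≤ a * (1 + 1 / 50) ∧
          5 ≤ {w ∈ Y | w ≠ y ∧ w ≠ v ∧ dist y w ≤ a * (1 + 1 / 50) ∧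
            dist v w ≤ a * (1 + 1 / 50)}.ncard},
        ∃ f : ℕ → EuclideanSpace ℝ (Fin 3), f 0 = y ∧ (∀ n, f n ∈ Y) ∧
          (∀ n, f (n + 1) ∈ {v ∈ Y | v ≠ (f n) ∧ dist (f n) v ≤ a * (1 + 1 / 50) ∧
          5 ≤ {w ∈ Y | w ≠ (f n) ∧ w ≠ v ∧ dist (f n) w ≤ a * (1 + 1 / 50) ∧
            dist v w ≤ a * (1 + 1 / 50)}.ncard}) ∧
          ∃ n, f n = y') ∧
      (∃ h : EuclideanSpace ℝ (Fin 3) → ℝ,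
        (∀ u ∈ Y, ∀ v ∈ Y, dist u v ≤ a * (1 + 1 / 50) → |h u - h v| ≤ 1) ∧
        (∀ y ∈ Y, ∀ v ∈ {v ∈ Y | v ≠ y ∧ dist y v ≤ a * (1 + 1 / 50) ∧
          5 ≤ {w ∈ Y | w ≠ y ∧ w ≠ v ∧ dist y w ≤ a * (1 + 1 / 50) ∧
            dist v w ≤ a * (1 + 1 / 50)}.ncard},
          |h y - h v| = 1) ∧
        (∀ y ∈ Y, ∀ v ∈ {v ∈ Y | v ≠ y ∧ dist y v ≤ a * (1 + 1 / 50) ∧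
          5 ≤ {w ∈ Y | w ≠ y ∧ w ≠ v ∧ dist y w ≤ a * (1 + 1 / 50) ∧
            dist v w ≤ a * (1 + 1 / 50)}.ncard},
          ∀ v' ∈ {v ∈ Y | v ≠ y ∧ dist y v ≤ a * (1 + 1 / 50) ∧
          5 ≤ {w ∈ Y | w ≠ y ∧ w ≠ v ∧ dist y w ≤ a * (1 + 1 / 50) ∧
            dist v w ≤ a * (1 + 1 / 50)}.ncard},
          v ≠ v' → h v + h v' = 2 * h y)) := by
  intro hRG hVG Y a ha hne hgap htf _hF1 _hPar _hN _hW hL hGreedy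
  -- the bond graph on `↥Y`
  obtain ⟨G, hG⟩ := ffrRT_graph_exists Y (a * (1 + 1 / 50))
  -- its labelled links, connectedness, local finiteness and cubic growth
  have hlinks := ffrRT_links G hG _ _ _ hL
  have hconn : G.Connected := ffrRT_connected G hG hne hGreedy
  have hloc : ∀ v : ↥Y, {w | G.Adj v w}.Finite := fun v => by
    obtain ⟨e, -, hrange, -⟩ := hlinks v
    rw [← hrange]
    exact Set.finite_range e
  have hcore : ∀ y ∈ Y, ∀ w ∈ Y, w ≠ y → a * (1 - 1 / 50) ≤ dist y w :=
    fun y hy w hw hwy => ((hgap y hy).2 w hw hwy).1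
  have hNFS := stub_ffrNoFreeSurface stub_ffrLens stub_ffrCircle.2 Y a ha hgap htf
  have hRD := stub_ffrRelDense Y a ha hne hgap hNFS
  have hgrowth := ffrRT_growth ha G hconn hloc (ffrRT_walk G hG hGreedy) (hVG Y a ha hcore hRD)
  -- the graph theorem
  obtain ⟨hU, h, hb, hfb, hmid⟩ := hRG (↥Y) G hlinks hconn hgrowth
  have hext : ∀ (x : EuclideanSpace ℝ (Fin 3)) (hx : x ∈ Y),
      Function.extend Subtype.val h 0 x = h ⟨x, hx⟩ := ffrRT_extend_val h
  refine ⟨?_, Function.extend Subtype.val h 0, ?_, ?_, ?_⟩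
  · -- (U) five-fold walks between five-sites
    intro y hy y' hy'
    obtain ⟨f, hf0, hfstep, n, hfn⟩ :=
      hU ⟨y, hy.1⟩ (ffrRT_fiveSite G hG y hy.1 hy.2) ⟨y', hy'.1⟩ (ffrRT_fiveSite G hG y' hy'.1 hy'.2)
    exact ⟨fun n => (f n : EuclideanSpace ℝ (Fin 3)), congrArg Subtype.val hf0, fun n => (f n).2,
      fun n => (ffrRT_fiveBond_iff G hG (f n) (f (n + 1))).2 (hfstep n), n, congrArg Subtype.val hfn⟩
  · -- (H) bonds change the height by at most one
    intro u hu v hv hd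
    rcases eq_or_ne u v with rfl | huv
    · rw [sub_self, abs_zero]
      exact zero_le_one
    · rw [hext u hu, hext v hv]
      exact hb ⟨u, hu⟩ ⟨v, hv⟩ ((hG _ _).2 ⟨huv, hd⟩)
  · -- (H) five-bonds change the height by exactly one
    intro y hy v hv
    rw [hext y hy, hext v hv.1]
    exact hfb ⟨y, hy⟩ ⟨v, hv.1⟩ ((ffrRT_fiveBond_iff G hG ⟨y, hy⟩ ⟨v, hv.1⟩).1 hv)
  · -- (H) the two five-bond partners of a five-site sit at heights symmetric about it
    intro y hy v hv v' hv' hvv'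
    rw [hext y hy, hext v hv.1, hext v' hv'.1]
    exact hmid ⟨y, hy⟩ ⟨v, hv.1⟩ ((ffrRT_fiveBond_iff G hG ⟨y, hy⟩ ⟨v, hv.1⟩).1 hv) ⟨v', hv'.1⟩
      ((ffrRT_fiveBond_iff G hG ⟨y, hy⟩ ⟨v', hv'.1⟩).1 hv') fun heq => hvv' (congrArg Subtype.val heq)

end Summit.AtomisticToContinuum.Crystallization.Theorems

end
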